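import Summits.Ventures.Crystal3D.Theorems.StickyWulffConstantTextureLiminfPlateLedger
import Summits.Ventures.Crystal3D.Theorems.StickyWulffConstantTextureLiminfTexShadowWallDefs
import HarnessLib

/-!
# Inner-face bookkeeping of the wall cell: the payer sum in T currency, and the currency glue to `BilayerWallAt`
# (lane T, the T-side port of lane G's walker ledger; crux `TextureLiminf`, stmt-Ventures-19483)

HONEST FRAMING. Venture `Summits/Ventures/Crystal3D` (cell `crystal3d-full`), helper `--supports` the crux
`TextureLiminf` (stmt-Ventures-19483) of `route-Ventures-StickyWulffConstant`, registered line `TexShadow` (v6.5; cf-p1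
ROUTE.md §86(23) R / §86(26) U: `stub_bilayerWallGeneric` = lane G's walker ledger with per-top frames on Barlow plates,
concluding `BilayerWallAt`; T-side port = Barlow sealing + inner-face bookkeeping + flux count).  Rung credit only; F-C1 not
moved.  NOT the wall law.

* **`payerSum_le_currency`** — in the cell of `BilayerWallAt C R₀ σ₁ σ₂ L₁ L₂ s₁ s₂ c` (`R₀ ≥ 3`; unit-separated `X` in
  `cyl R₀ h ρ`, complete clamped plates `P₁ ⊆ stacking L₁ s₁ σ₁` in `[−2R₀, −R₀]`, `P₂ ⊆ stacking L₂ s₂ σ₂` in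
  `[h+R₀, h+2R₀]`, `Y = (X ∖ P₁) ∖ P₂`, `deg y = #(X.filter (dist y · = 1))`,
  `PAY = {y ∈ X : deg y ≠ 12, −R₀−2 ≤ y₂ ≤ h+R₀+2}` as in `…GenericWallFloorWalkerFamilyLedger`):
  `Σ_{y ∈ PAY} (12 − deg y) + 2·cross(P₁, X ∖ P₁) + 2·cross(P₂, Y) ≤ 2·D(Y) + innerBonds₁ + innerBonds₂ + (3456 + 1152(R₀+1))·ρ`
  (filling: `2D(Y) = Σ_Y (12 − deg_Y)`, no `P₁–P₂` contacts; plates: `bottomPlate_ledger` / `topPlate_ledger` of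
  `…TextureLiminfPlateLedger`);
* **`bilayerWallAt_of_payerBound`** — the CURRENCY GLUE: if in every cell the charge of the table `c` is dominated by the
  payer sum, `2·Σ_ij c_ij·|unit slice ∩ laySlab₁ i ∩ laySlab₂ j| ≤ Σ_{PAY} (12 − deg) + C'(1+h)ρ` — exactly what the walker
  families deliver (flux count + injectivity + sealing of the ends) — then `BilayerWallAt ((C' + 3456 + 1152(R₀+1))/2) R₀ …`.
So lane T's two wall stubs are reduced to ONE inequality in lane G's payer currency on Barlow plates; what remains of the
T-side port is the FLUX COUNT of the per-top walker families (CAP-START, 19480-p2 p636997) strip by strip.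
WHAT THIS IS NOT: not the stubs; the residual class and the zigzag deficit are not touched; F-C1 not moved.
-/

noncomputable section

namespace Summit.Ventures.Crystal3D.Theorems

open Finset Summit.Ventures.Crystal3D
open Literature.MathematicalPhysics.StatisticalMechanics (IsHaggSeq contactDeficiency)
open Summit.Ventures.Crystal3D.Cruxes.TextureLiminf.TexShadow (E3 stacking cyl innerBonds BilayerWallAt)
open scoped InnerProductSpace

/-! ## The wall cell: the payer sum in T currency -/

open scoped Classical in
/-- **The payer sum of the wall cell in T currency.**  In the cell of `BilayerWallAt C R₀ …` (`R₀ ≥ 3`): with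
`Y = (X ∖ P₁) ∖ P₂`, `deg y = #(X.filter (dist y · = 1))` and `PAY = {y ∈ X : deg y ≠ 12, −R₀−2 ≤ y₂ ≤ h+R₀+2}`,
`Σ_{y ∈ PAY} (12 − deg y) + 2·cross(P₁, X ∖ P₁) + 2·cross(P₂, Y) ≤ 2·D(Y) + innerBonds₁ + innerBonds₂ + (3456 + 1152(R₀+1))·ρ`. -/
theorem payerSum_le_currency {σ₁ σ₂ : ℤ → ℤ} (hσ₁ : IsHaggSeq σ₁) (hσ₂ : IsHaggSeq σ₂)
    (L₁ L₂ : E3 ≃ₗᵢ[ℝ] E3) (s₁ s₂ : E3) (R₀ h ρ : ℝ) (hR₀ : 3 ≤ R₀) (hh : 0 ≤ h) (hρ : R₀ ≤ ρ)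
    (X P₁ P₂ : Finset E3) (hX : ∀ p ∈ X, ∀ q ∈ X, p ≠ q → 1 ≤ dist p q) (hP₁X : P₁ ⊆ X) (hP₂X : P₂ ⊆ X \ P₁)
    (hcell : ∀ p ∈ X, p ∈ cyl R₀ h ρ)
    (hP₁ : ∀ p, p ∈ P₁ ↔ (p ∈ stacking L₁ s₁ σ₁ ∧ -(2 * R₀) ≤ p 2 ∧ p 2 ≤ -R₀ ∧ p 0 ^ 2 + p 1 ^ 2 ≤ ρ ^ 2))
    (hP₂ : ∀ p, p ∈ P₂ ↔ (p ∈ stacking L₂ s₂ σ₂ ∧ h + R₀ ≤ p 2 ∧ p 2 ≤ h + 2 * R₀ ∧ p 0 ^ 2 + p 1 ^ 2 ≤ ρ ^ 2)) :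
    (∑ y ∈ X.filter (fun y => (X.filter fun q => dist y q = 1).card ≠ 12 ∧ -R₀ - 2 ≤ y 2 ∧ y 2 ≤ h + R₀ + 2),
        ((12 : ℝ) - ((X.filter fun q => dist y q = 1).card : ℝ))) +
      2 * ((((P₁ ×ˢ (X \ P₁)).filter fun pq => dist pq.1 pq.2 = 1).card : ℕ) : ℝ) +
      2 * ((((P₂ ×ˢ ((X \ P₁) \ P₂)).filter fun pq => dist pq.1 pq.2 = 1).card : ℕ) : ℝ) ≤
      2 * contactDeficiency ((X \ P₁) \ P₂) +
        innerBonds (stacking L₁ s₁ σ₁) P₁ (fun q => -R₀ < q 2) +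
        innerBonds (stacking L₂ s₂ σ₂) P₂ (fun q => q 2 < h + R₀) +
        (3456 + 1152 * (R₀ + 1)) * ρ := by
  set Y := (X \ P₁) \ P₂ with hYdef
  set πp : E3 → Prop := fun y => (X.filter fun q => dist y q = 1).card ≠ 12 ∧ -R₀ - 2 ≤ y 2 ∧ y 2 ≤ h + R₀ + 2
    with hπp
  set f : E3 → ℝ := fun y => (12 : ℝ) - ((X.filter fun q => dist y q = 1).card : ℝ) with hfdef
  have hX' : ∀ p ∈ X \ P₁, ∀ q ∈ X \ P₁, p ≠ q → 1 ≤ dist p q :=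
    fun p hp q hq hne => hX p (Finset.sdiff_subset hp) q (Finset.sdiff_subset hq) hne
  have hP₂X' : P₂ ⊆ X := hP₂X.trans Finset.sdiff_subset
  have hYX' : Y ⊆ X \ P₁ := Finset.sdiff_subset
  have hρ2 : (2 : ℝ) ≤ ρ := by linarith
  have hf0 : ∀ y, 0 ≤ f y := fun y => by
    have : ((X.filter fun q => dist y q = 1).card : ℝ) ≤ 12 := by exact_mod_cast card_filter_dist_eq_one_le_twelve X hX y
    simp only [hfdef]; linarith
  -- split the payer sum along `X = Y ⊔ P₂ ⊔ P₁`
  have hsplit : ∑ y ∈ X.filter πp, f y = ∑ y ∈ Y.filter πp, f y + ∑ y ∈ P₂.filter πp, f y + ∑ y ∈ P₁.filter πp, f y := by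
    rw [Finset.sum_filter, Finset.sum_filter, Finset.sum_filter, Finset.sum_filter,
      ← Finset.sum_sdiff hP₁X, ← Finset.sum_sdiff hP₂X]
  -- the filling part
  have hdeg : ∀ y, ((X.filter fun q => dist y q = 1).card : ℝ) =
      ((Y.filter fun q => dist y q = 1).card : ℝ) + ((P₂.filter fun q => dist y q = 1).card : ℝ) +
        ((P₁.filter fun q => dist y q = 1).card : ℝ) := by
    intro y
    rw [card_filter_dist_eq_sdiff_add X P₁ hP₁X y, card_filter_dist_eq_sdiff_add (X \ P₁) P₂ hP₂X y]
  have hnocontact : ∀ p ∈ P₁, ((P₂.filter fun q => dist p q = 1).card : ℝ) = 0 := by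
    intro p hp
    obtain ⟨-, -, hp2, -⟩ := (hP₁ p).1 hp
    have : P₂.filter (fun q => dist p q = 1) = ∅ := by
      refine Finset.filter_eq_empty_iff.2 fun q hq hd => ?_
      obtain ⟨-, hq2, -, -⟩ := (hP₂ q).1 hq
      have h2 := sq_sub_apply_le_dist_sq q p 2
      rw [dist_comm, hd, one_pow] at h2
      nlinarith
    rw [this, Finset.card_empty, Nat.cast_zero]
  have hcross₁ : ∑ y ∈ Y, ((P₁.filter fun q => dist y q = 1).card : ℝ) =
      ((((P₁ ×ˢ (X \ P₁)).filter fun pq => dist pq.1 pq.2 = 1).card : ℕ) : ℝ) := by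
    rw [sum_card_filter_dist_comm Y P₁, card_filter_product_dist_eq_sum P₁ (X \ P₁)]
    refine Finset.sum_congr rfl fun p hp => ?_
    rw [card_filter_dist_eq_sdiff_add (X \ P₁) P₂ hP₂X p, hnocontact p hp, add_zero]
  have hcross₂ : ∑ y ∈ Y, ((P₂.filter fun q => dist y q = 1).card : ℝ) =
      ((((P₂ ×ˢ ((X \ P₁) \ P₂)).filter fun pq => dist pq.1 pq.2 = 1).card : ℕ) : ℝ) := by
    rw [sum_card_filter_dist_comm Y P₂, card_filter_product_dist_eq_sum P₂ ((X \ P₁) \ P₂)]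
  have hYsum : ∑ y ∈ Y.filter πp, f y ≤ 2 * contactDeficiency Y -
      ((((P₁ ×ˢ (X \ P₁)).filter fun pq => dist pq.1 pq.2 = 1).card : ℕ) : ℝ) -
      ((((P₂ ×ˢ ((X \ P₁) \ P₂)).filter fun pq => dist pq.1 pq.2 = 1).card : ℕ) : ℝ) := by
    have h1 : ∑ y ∈ Y.filter πp, f y ≤ ∑ y ∈ Y, f y :=
      Finset.sum_le_sum_of_subset_of_nonneg (Finset.filter_subset _ _) fun y _ _ => hf0 y
    have h2 : ∑ y ∈ Y, f y = ∑ y ∈ Y, ((12 : ℝ) - ((Y.filter fun q => dist y q = 1).card : ℝ)) -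
        ∑ y ∈ Y, ((P₂.filter fun q => dist y q = 1).card : ℝ) - ∑ y ∈ Y, ((P₁.filter fun q => dist y q = 1).card : ℝ) := by
      rw [← Finset.sum_sub_distrib, ← Finset.sum_sub_distrib]
      refine Finset.sum_congr rfl fun y _ => ?_
      simp only [hfdef]; rw [hdeg y]; ring
    rw [h2, ← two_mul_contactDeficiency_eq_sum Y, hcross₁, hcross₂] at h1
    linarith
  -- the two plates
  have hbot := bottomPlate_ledger hσ₁ L₁ s₁ (-(2 * R₀)) (-R₀) ρ (by linarith) hρ2 X P₁ (P₁.filter πp) hX hP₁X hP₁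
    (fun x hx => (hcell x hx).1) (Finset.filter_subset _ _)
    (fun p hp => by have := (Finset.mem_filter.1 hp).2.2.1; linarith)
  have htop := topPlate_ledger hσ₂ L₂ s₂ (h + R₀) (h + 2 * R₀) ρ (by linarith) hρ2 (X \ P₁) P₂ (P₂.filter πp) hX'
    hP₂X hP₂ (fun x hx => (hcell x (Finset.sdiff_subset hx)).2.1) (Finset.filter_subset _ _)
    (fun p hp => by have := (Finset.mem_filter.1 hp).2.2.2; linarith)
  -- the top plate's degrees in `X \ P₁` are at most those in `X`
  have htop' : ∑ p ∈ P₂.filter πp, f p ≤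
      ∑ p ∈ P₂.filter πp, ((12 : ℝ) - (((X \ P₁).filter fun q => dist p q = 1).card : ℝ)) := by
    refine Finset.sum_le_sum fun p _ => ?_
    have : (((X \ P₁).filter fun q => dist p q = 1).card : ℝ) ≤ ((X.filter fun q => dist p q = 1).card : ℝ) := by
      exact_mod_cast Finset.card_le_card (Finset.filter_subset_filter _ Finset.sdiff_subset)
    simp only [hfdef]; linarith
  -- the inner bond counts are `innerBonds`
  have hin₁ : ∑ p ∈ P₁, (({q : E3 | q ∈ stacking L₁ s₁ σ₁ ∧ dist p q = 1 ∧ -R₀ < q 2}).ncard : ℝ) =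
      innerBonds (stacking L₁ s₁ σ₁) P₁ (fun q => -R₀ < q 2) := rfl
  have hin₂ : ∑ p ∈ P₂, (({q : E3 | q ∈ stacking L₂ s₂ σ₂ ∧ dist p q = 1 ∧ q 2 < h + R₀}).ncard : ℝ) =
      innerBonds (stacking L₂ s₂ σ₂) P₂ (fun q => q 2 < h + R₀) := rfl
  have hconst : (1728 + 576 * (-R₀ - -(2 * R₀) + 1)) * ρ + (1728 + 576 * (h + 2 * R₀ - (h + R₀) + 1)) * ρ =
      (3456 + 1152 * (R₀ + 1)) * ρ := by ring
  rw [hsplit]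
  linarith [hYsum, hbot, htop, htop', hin₁, hin₂, hconst]

/-- **The currency glue.**  If in every wall cell the charge of the table `c` is dominated by the payer sum,
`2·Q(c) ≤ Σ_{y ∈ PAY} (12 − deg y) + C'(1+h)ρ` — what lane G's walker families deliver (flux count, injectivity,
sealing of the ends at unsaturated balls of the window) — then the cell inequality `BilayerWallAt` holds with rim constant
`(C' + 3456 + 1152(R₀+1))/2`. -/
theorem bilayerWallAt_of_payerBound {σ₁ σ₂ : ℤ → ℤ} (hσ₁ : IsHaggSeq σ₁) (hσ₂ : IsHaggSeq σ₂)
    (L₁ L₂ : E3 ≃ₗᵢ[ℝ] E3) (s₁ s₂ : E3) (R₀ C' : ℝ) (hR₀ : 3 ≤ R₀) (c : ℤ → ℤ → ℝ)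
    (hpay : ∀ h : ℝ, 0 ≤ h → ∀ ρ : ℝ, R₀ ≤ ρ → ∀ X P₁ P₂ : Finset E3,
      (∀ p ∈ X, ∀ q ∈ X, p ≠ q → 1 ≤ dist p q) → P₁ ⊆ X → P₂ ⊆ X \ P₁ → (∀ p ∈ X, p ∈ cyl R₀ h ρ) →
      (∀ p, p ∈ P₁ ↔ (p ∈ stacking L₁ s₁ σ₁ ∧ -(2 * R₀) ≤ p 2 ∧ p 2 ≤ -R₀ ∧ p 0 ^ 2 + p 1 ^ 2 ≤ ρ ^ 2)) →
      (∀ p, p ∈ P₂ ↔ (p ∈ stacking L₂ s₂ σ₂ ∧ h + R₀ ≤ p 2 ∧ p 2 ≤ h + 2 * R₀ ∧ p 0 ^ 2 + p 1 ^ 2 ≤ ρ ^ 2)) →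
      2 * (∑' ij : ℤ × ℤ, c ij.1 ij.2 *
          (MeasureTheory.volume ({q : E3 | 0 ≤ q 2 ∧ q 2 ≤ 1 ∧ q 0 ^ 2 + q 1 ^ 2 ≤ ρ ^ 2} ∩
            Summit.Ventures.Crystal3D.Cruxes.TextureLiminf.TexShadow.laySlab L₁ s₁ ij.1 ∩
            Summit.Ventures.Crystal3D.Cruxes.TextureLiminf.TexShadow.laySlab L₂ s₂ ij.2)).toReal) ≤
        (∑ y ∈ X.filter (fun y => (X.filter fun q => dist y q = 1).card ≠ 12 ∧ -R₀ - 2 ≤ y 2 ∧ y 2 ≤ h + R₀ + 2),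
          ((12 : ℝ) - ((X.filter fun q => dist y q = 1).card : ℝ))) + C' * (1 + h) * ρ) :
    BilayerWallAt ((C' + 3456 + 1152 * (R₀ + 1)) / 2) R₀ σ₁ σ₂ L₁ L₂ s₁ s₂ c := by
  classical
  intro h hh ρ hρ X P₁ P₂ hX hP₁X hP₂X hcell hP₁ hP₂
  have hcur := payerSum_le_currency hσ₁ hσ₂ L₁ L₂ s₁ s₂ R₀ h ρ hR₀ hh hρ X P₁ P₂ hX hP₁X hP₂X hcell hP₁ hP₂
  have hp := hpay h hh ρ hρ X P₁ P₂ hX hP₁X hP₂X hcell hP₁ hP₂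
  have hρ0 : 0 ≤ ρ := by linarith
  have hrim : (3456 + 1152 * (R₀ + 1)) * ρ ≤ (3456 + 1152 * (R₀ + 1)) * (1 + h) * ρ := by
    have h1 : 0 ≤ (3456 + 1152 * (R₀ + 1)) * ρ := by positivity
    nlinarith
  linarith

end Summit.Ventures.Crystal3D.Theorems

end
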